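import Summits.CriticalPhenomena.CardyFormulaZ2.Theorems.CardyBoundaryCoulombGasRectilinearCardySectorCrossing
import Summits.CriticalPhenomena.CardyFormulaZ2.Theorems.CardyBoundaryCoulombGasRectilinearCardySectorWalks

/-!
# Stub `stub_boundaryArmTightness`, assembly III: from the four long-way crossings to a crossing
# of the discrete domain near the junction
# (line `excursion-kernel-covariance`, crux `RectilinearCardy`, stmt-CriticalPhenomena-5660)

`mem_discreteCrossing_of_fourCross`: in a wedge of `m ∈ {1, 2, 3}` quadrants at a boundary point
`b` (frame `a`), the four long-way open crossings of the square annulus `c + A(l)` around the site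
`c` nearest to `b` force an open path of `Ω_δ` from the discrete arc of the boundary set carrying
the start ray to that of the set carrying the end ray: turn the crossings to the standard frame
(`fourWalks_relabel_quarterTurn_iterate`), build the sector walk there
(`exists_sectorWalk_one/two/three`) and conclude by `mem_discreteCrossing_of_sectorWalk`.
-/

noncomputable section

open Set Filter Topology MeasureTheory Metric
open Literature.Probability.RandomPlanarGeometry
open Literature.Probability.Percolation
open Literature.Probability.LatticeModels (Site zdGraph meshPoint meshDomain meshBoundary discreteArc
  meshVertices)

namespace Summit.CriticalPhenomena.CardyFormulaZ2.Cruxes.RectilinearCardy.ExcursionKernelCovariance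

/-- Real and imaginary parts of the frame coordinate `δ (p + q i) - βδ`, `βδ = δ β`. [folklore] -/
theorem re_im_frame_lattice {δ : ℝ} (hδ : 0 < δ) (βδ : ℂ) (p q : ℤ) :
    ((δ : ℂ) * ((p : ℂ) + (q : ℂ) * Complex.I) - βδ).re = δ * ((p : ℝ) - (βδ / (δ : ℂ)).re) ∧
      ((δ : ℂ) * ((p : ℂ) + (q : ℂ) * Complex.I) - βδ).im = δ * ((q : ℝ) - (βδ / (δ : ℂ)).im) := by
  have h1 : (βδ / (δ : ℂ)).re = βδ.re / δ := Complex.div_ofReal_re _ _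
  have h2 : (βδ / (δ : ℂ)).im = βδ.im / δ := Complex.div_ofReal_im _ _
  rw [h1, h2]
  constructor
  · simp; field_simp
  · simp; field_simp

set_option maxHeartbeats 800000 in
/-- **From the four long-way crossings to a crossing of the discrete domain near the junction.**
In the setting of `mem_discreteCrossing_of_sectorWalk` (wedge of `m` quadrants at `b` in the
frame `a`, target sets `P₁`, `P₂`, site `c` within `δ` of `b`, scale `l ≥ 3` with
`λ ≤ (l - 3)δ`, `20 l δ ≤ r`, bulk at depth `κ ≤ (l - 2)δ` in `Ω_δ`): if the lattice configuration
`ω` has open left-right crossings of the top and bottom boxes and open top-bottom crossings of the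
left and right boxes of the square annulus `c + A(l)`, then `ω ∈ discreteCrossing D δ P₁ P₂`.
Proof: turn the four crossings to the standard frame (`fourWalks_relabel_quarterTurn_iterate`),
build the sector walk of `m` quadrants there (`exists_sectorWalk_one/two/three`) with the
thresholds `⌊β.re⌋ + 1`, `⌊β.im⌋ + 1`, `⌈β.re⌉ - 1`, and apply
`mem_discreteCrossing_of_sectorWalk`. [folklore] -/
theorem mem_discreteCrossing_of_fourCross (D : JordanDomain) {b : ℂ} {r : ℝ}
    {a m : ℕ} (hm : m = 1 ∨ m = 2 ∨ m = 3) {A₁ A₂ P₁ P₂ : Set ℂ}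
    (hfront : ∀ z ∈ frontier D.carrier, dist z b < r → z ∈ A₁ ∨ z ∈ A₂)
    (hA₁ : ∀ z, dist z b < r → (z ∈ A₁ ↔ ((z - b) * (-Complex.I) ^ a).im = 0 ∧
      0 ≤ ((z - b) * (-Complex.I) ^ a).re))
    (hA₂ : ∀ z, dist z b < r → (z ∈ A₂ ↔ ((z - b) * (-Complex.I) ^ (a + m)).im = 0 ∧
      0 ≤ ((z - b) * (-Complex.I) ^ (a + m)).re))
    (hΩ : ∀ z, dist z b < r → (z ∈ D.carrier ↔
      (m = 1 → 0 < ((z - b) * (-Complex.I) ^ a).re ∧ 0 < ((z - b) * (-Complex.I) ^ a).im) ∧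
      (m = 2 → 0 < ((z - b) * (-Complex.I) ^ a).im) ∧
      (m = 3 → 0 < ((z - b) * (-Complex.I) ^ a).im ∨ ((z - b) * (-Complex.I) ^ a).re < 0)))
    {lam : ℝ} (hlam : 0 ≤ lam)
    (hP₁ne : (frontier D.carrier \ P₁).Nonempty) (hP₂ne : (frontier D.carrier \ P₂).Nonempty)
    (hP₁a : ∀ z ∈ A₁, lam < dist z b → z ∈ P₁)
    (hP₁b : ∀ z ∈ frontier D.carrier, z ∉ P₁ → dist z b < r → z ∈ A₂ ∨ dist z b ≤ lam)
    (hP₂a : ∀ z ∈ A₂, lam < dist z b → z ∈ P₂)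
    (hP₂b : ∀ z ∈ frontier D.carrier, z ∉ P₂ → dist z b < r → z ∈ A₁ ∨ dist z b ≤ lam)
    {δ : ℝ} (hδ : 0 < δ) {c : Site 2} (hcb : dist (meshPoint δ c) b ≤ δ) {l : ℕ} (hl : 3 ≤ l)
    (hlaml : lam ≤ ((l : ℝ) - 3) * δ) (hfit : 20 * (l : ℝ) * δ ≤ r)
    {κ : ℝ} (hκl : κ ≤ ((l : ℝ) - 2) * δ)
    (hbulk : ∀ x : Site 2, meshPoint δ x ∈ D.carrier → dist (meshPoint δ x) b ≤ r / 2 →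
      κ ≤ infDist (meshPoint δ x) (frontier D.carrier) → x ∈ meshDomain D.carrier δ)
    {ω : BondConfig (Site 2)} (hω : ω ⊆ (zdGraph 2).edgeSet)
    (hcross : ω ∈ lrCrossingAt (c + ![-(3 * l : ℤ), (l : ℤ) + 1]) (6 * l) (2 * l - 1) ∩
        lrCrossingAt (c + ![-(3 * l : ℤ), -(3 * l : ℤ)]) (6 * l) (2 * l - 1) ∩
        openCrossing ((· + (c + ![-(3 * l : ℤ), -(3 * l : ℤ)])) ''
            (rectangle (2 * l - 1) (6 * l) : Set (Site 2)))
          ((· + (c + ![-(3 * l : ℤ), -(3 * l : ℤ)])) '' (bottomSide (2 * l - 1) (6 * l) : Set (Site 2)))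
          ((· + (c + ![-(3 * l : ℤ), -(3 * l : ℤ)])) '' (topSide (2 * l - 1) (6 * l) : Set (Site 2))) ∩
        openCrossing ((· + (c + ![(l : ℤ) + 1, -(3 * l : ℤ)])) ''
            (rectangle (2 * l - 1) (6 * l) : Set (Site 2)))
          ((· + (c + ![(l : ℤ) + 1, -(3 * l : ℤ)])) '' (bottomSide (2 * l - 1) (6 * l) : Set (Site 2)))
          ((· + (c + ![(l : ℤ) + 1, -(3 * l : ℤ)])) '' (topSide (2 * l - 1) (6 * l) : Set (Site 2)))) :
    ω ∈ discreteCrossing D.carrier δ P₁ P₂ := by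
  classical
  have hl1 : 1 ≤ l := by omega
  have hk : ((2 * l - 1 : ℕ) : ℤ) = 2 * l - 1 := by omega
  have h6 : ((6 * l : ℕ) : ℤ) = 6 * l := by push_cast; ring
  -- the four open walks
  obtain ⟨⟨⟨hT, hB⟩, hL⟩, hR⟩ := hcross
  obtain ⟨aT, bT, T, haT, hbT, hTs, hTe⟩ := exists_walk_of_mem_lrCrossingAt hω hT
  obtain ⟨aB, bB, B, haB, hbB, hBs, hBe⟩ := exists_walk_of_mem_lrCrossingAt hω hB
  obtain ⟨aL, bL, L, haL, hbL, hLs, hLe⟩ := exists_walk_of_mem_tbCrossingAt hω hL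
  obtain ⟨aR, bR, R, haR, hbR, hRs, hRe⟩ := exists_walk_of_mem_tbCrossingAt hω hR
  simp only [Pi.add_apply, Matrix.cons_val_zero, Matrix.cons_val_one] at haT hbT hTs haB hbB hBs
  simp only [Pi.add_apply, Matrix.cons_val_zero, Matrix.cons_val_one] at haL hbL hLs haR hbR hRs
  rw [hk] at hTs hBs hLs hRs
  rw [h6] at hbT hTs hbB hBs hbL hLs hbR hRs
  have hdatum := fourWalks_relabel_quarterTurn_iterate (c := c) (l := l) a (ω := ω)
    ⟨⟨aT, bT, T, by omega, by omega, fun z hz => by have := hTs z hz; omega, hTe⟩,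
      ⟨aB, bB, B, by omega, by omega, fun z hz => by have := hBs z hz; omega, hBe⟩,
      ⟨aL, bL, L, by omega, by omega, fun z hz => by have := hLs z hz; omega, hLe⟩,
      ⟨aR, bR, R, by omega, by omega, fun z hz => by have := hRs z hz; omega, hRe⟩⟩
  obtain ⟨⟨aT', bT', T', haT', hbT', hTs', hTe'⟩, ⟨aB', bB', B', haB', hbB', hBs', hBe'⟩,
    ⟨aL', bL', L', haL', hbL', hLs', hLe'⟩, ⟨aR', bR', R', haR', hbR', hRs', hRe'⟩⟩ := hdatum
  -- the reduced offset and the thresholds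
  set βδ : ℂ := (b - meshPoint δ c) * (-Complex.I) ^ a with hβδ
  set β : ℂ := βδ / (δ : ℂ) with hβ
  have hl' : (3 : ℝ) ≤ l := by exact_mod_cast hl
  have hβδn : ‖βδ‖ ≤ δ := by
    rw [hβδ, norm_mul, norm_pow, norm_neg, Complex.norm_I, one_pow, mul_one, ← dist_eq_norm,
      dist_comm]; exact hcb
  have hβn : ‖β‖ ≤ 1 := by
    rw [hβ, norm_div, Complex.norm_real, Real.norm_eq_abs, abs_of_pos hδ, div_le_one hδ]
    exact hβδn
  have hβre := abs_le.1 ((Complex.abs_re_le_norm β).trans hβn)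
  have hβim := abs_le.1 ((Complex.abs_im_le_norm β).trans hβn)
  have hfre := Int.floor_le β.re
  have hfre' := Int.lt_floor_add_one β.re
  have hfim := Int.floor_le β.im
  have hfim' := Int.lt_floor_add_one β.im
  have hcre := Int.le_ceil β.re
  have hcre' := Int.ceil_lt_add_one β.re
  have hx₀ : |⌊β.re⌋ + 1| ≤ 2 := by
    have h1 : (⌊β.re⌋ : ℝ) ≤ 1 := by linarith
    have h2 : (-2 : ℝ) < ⌊β.re⌋ := by linarith
    have h1' : ⌊β.re⌋ ≤ 1 := by exact_mod_cast h1
    have h2' : -2 < ⌊β.re⌋ := by exact_mod_cast h2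
    rw [abs_le]; omega
  have hy₀ : |⌊β.im⌋ + 1| ≤ 2 := by
    have h1 : (⌊β.im⌋ : ℝ) ≤ 1 := by linarith
    have h2 : (-2 : ℝ) < ⌊β.im⌋ := by linarith
    have h1' : ⌊β.im⌋ ≤ 1 := by exact_mod_cast h1
    have h2' : -2 < ⌊β.im⌋ := by exact_mod_cast h2
    rw [abs_le]; omega
  have hx₁ : |⌈β.re⌉ - 1| ≤ 2 := by
    have h1 : (⌈β.re⌉ : ℝ) < 2 := by linarith
    have h2 : (-1 : ℝ) ≤ ⌈β.re⌉ := by linarith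
    have h1' : ⌈β.re⌉ < 2 := by exact_mod_cast h1
    have h2' : -1 ≤ ⌈β.re⌉ := by exact_mod_cast h2
    rw [abs_le]; omega
  -- frame coordinates of standard-frame lattice points
  have hUri : ∀ p q : ℤ, ((δ : ℂ) * ((p : ℂ) + (q : ℂ) * Complex.I) - βδ).re = δ * ((p : ℝ) - β.re) ∧
      ((δ : ℂ) * ((p : ℂ) + (q : ℂ) * Complex.I) - βδ).im = δ * ((q : ℝ) - β.im) :=
    fun p q => re_im_frame_lattice hδ βδ p q
  have hnorm_re : ∀ w : ℂ, |w.re| ≤ ‖w‖ := fun w => Complex.abs_re_le_norm w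
  have hnorm_im : ∀ w : ℂ, |w.im| ≤ ‖w‖ := fun w => Complex.abs_im_le_norm w
  have hδ1 : ((l : ℝ) - 1) * δ ≤ δ * ((l : ℝ) - 1) := by linarith
  -- the common part, with the sector walk of `m` quadrants
  rcases hm with rfl | rfl | rfl
  · -- one quadrant
    obtain ⟨vE, vX, W₀, hW₀e, hW₀s, hvE, hvX, h, hh, hh0, hh1⟩ :=
      exists_sectorWalk_one hl hx₀ hy₀ T' haT' hbT' hTs' hTe' R' haR' hbR' hRs' hRe'
    refine mem_discreteCrossing_of_sectorWalk D (Or.inl rfl) hfront hA₁ hA₂ hΩ hlam hP₁ne hP₂ne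
      hP₁a hP₁b hP₂a hP₂b hδ hcb hl hlaml hfit hκl hbulk W₀ hW₀e (fun z hz => ?_) hvE ?_ ?_ hh ?_
    · have := hW₀s z hz
      exact ⟨⟨fun _ => ⟨this.1, this.2.1⟩, fun h => absurd h (by norm_num),
        fun h => absurd h (by norm_num)⟩, this.2.2.1, this.2.2.2⟩
    · obtain ⟨hre, him⟩ := hUri (vX 0 - c 0) (vX 1 - c 1)
      have e1 : ∀ w : ℂ, (w * (-Complex.I) ^ 1).re = w.im := fun w => by simp
      have e2 : ∀ w : ℂ, (w * (-Complex.I) ^ 1).im = -w.re := fun w => by simp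
      rw [e1, e2, hre, him, hvX.1, abs_neg, abs_mul, abs_of_pos hδ]
      have hq : (l : ℝ) ≤ ((vX 1 - c 1 : ℤ) : ℝ) := by exact_mod_cast hvX.2
      have hp : |(((⌊β.re⌋ + 1 : ℤ)) : ℝ) - β.re| ≤ 1 := by
        push_cast; exact abs_le.2 ⟨by linarith, by linarith⟩
      exact ⟨by nlinarith, by nlinarith⟩
    · refine ⟨vX - Pi.single 0 1, (zdGraph_two_adj_iff _ _).2 (Or.inr (Or.inl ⟨by simp, by simp⟩)),
        ?_, ?_, fun hsec => ?_⟩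
      · have := abs_le.1 (hW₀s vX W₀.end_mem_support).2.2.1
        simp only [Pi.sub_apply, Pi.single_eq_same]; rw [abs_le]; omega
      · have := abs_le.1 (hW₀s vX W₀.end_mem_support).2.2.2
        simp only [Pi.sub_apply, Pi.single_eq_of_ne (one_ne_zero), sub_zero]; rw [abs_le]; omega
      · have h1 := (hsec.1 rfl).1
        obtain ⟨hre, -⟩ := hUri ((vX - Pi.single 0 1 : Site 2) 0 - c 0)
          ((vX - Pi.single 0 1 : Site 2) 1 - c 1)
        rw [hre] at h1
        have e : (vX - Pi.single 0 1 : Site 2) 0 - c 0 = ⌊β.re⌋ := by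
          simp only [Pi.sub_apply, Pi.single_eq_same]; omega
        rw [e] at h1
        nlinarith
    · intro ρ hρ
      obtain ⟨hre, him⟩ := hUri (h 0 - c 0) (h 1 - c 1)
      have hq : (l : ℝ) ≤ ((h 1 - c 1 : ℤ) : ℝ) := by exact_mod_cast hh1
      have hp : (l : ℝ) ≤ ((h 0 - c 0 : ℤ) : ℝ) := by exact_mod_cast hh0
      constructor
      · refine le_trans ?_ (hnorm_im _)
        rw [Complex.sub_im, Complex.ofReal_im, sub_zero, him, abs_mul, abs_of_pos hδ]
        nlinarith [le_abs_self (((h 1 - c 1 : ℤ) : ℝ) - β.im)]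
      · refine le_trans ?_ (hnorm_re _)
        have e : ((ρ : ℂ) * Complex.I ^ 1).re = 0 := by simp
        rw [Complex.sub_re, e, sub_zero, hre, abs_mul, abs_of_pos hδ]
        nlinarith [le_abs_self (((h 0 - c 0 : ℤ) : ℝ) - β.re)]
  · -- two quadrants
    obtain ⟨vE, vX, W₀, hW₀e, hW₀s, hvE, hvX, h, hh, hh1⟩ :=
      exists_sectorWalk_two hl hy₀ T' haT' hbT' hTs' hTe' L' haL' hbL' hLs' hLe' R' haR' hbR' hRs' hRe'
    refine mem_discreteCrossing_of_sectorWalk D (Or.inr (Or.inl rfl)) hfront hA₁ hA₂ hΩ hlam hP₁ne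
      hP₂ne hP₁a hP₁b hP₂a hP₂b hδ hcb hl hlaml hfit hκl hbulk W₀ hW₀e (fun z hz => ?_) hvE ?_ ?_ hh ?_
    · have := hW₀s z hz
      exact ⟨⟨fun h => absurd h (by norm_num), fun _ => this.1, fun h => absurd h (by norm_num)⟩,
        this.2.1, this.2.2⟩
    · obtain ⟨hre, him⟩ := hUri (vX 0 - c 0) (vX 1 - c 1)
      have e1 : ∀ w : ℂ, (w * (-Complex.I) ^ 2).re = -w.re := fun w => by simp [pow_two]
      have e2 : ∀ w : ℂ, (w * (-Complex.I) ^ 2).im = -w.im := fun w => by simp [pow_two]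
      rw [e1, e2, hre, him, hvX.1, abs_neg, abs_mul, abs_of_pos hδ]
      have hp : ((vX 0 - c 0 : ℤ) : ℝ) ≤ -(l : ℝ) := by exact_mod_cast hvX.2
      have hq : |(((⌊β.im⌋ + 1 : ℤ)) : ℝ) - β.im| ≤ 1 := by
        push_cast; exact abs_le.2 ⟨by linarith, by linarith⟩
      exact ⟨by nlinarith, by nlinarith⟩
    · refine ⟨vX - Pi.single 1 1, (zdGraph_two_adj_iff _ _).2
        (Or.inr (Or.inr (Or.inr ⟨by simp, by simp⟩))), ?_, ?_, fun hsec => ?_⟩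
      · have := abs_le.1 (hW₀s vX W₀.end_mem_support).2.1
        simp only [Pi.sub_apply, Pi.single_eq_of_ne (zero_ne_one), sub_zero]; rw [abs_le]; omega
      · have := abs_le.1 (hW₀s vX W₀.end_mem_support).2.2
        simp only [Pi.sub_apply, Pi.single_eq_same]; rw [abs_le]; omega
      · have h1 := hsec.2.1 rfl
        obtain ⟨-, him⟩ := hUri ((vX - Pi.single 1 1 : Site 2) 0 - c 0)
          ((vX - Pi.single 1 1 : Site 2) 1 - c 1)
        rw [him] at h1
        have e : (vX - Pi.single 1 1 : Site 2) 1 - c 1 = ⌊β.im⌋ := by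
          simp only [Pi.sub_apply, Pi.single_eq_same]; omega
        rw [e] at h1
        nlinarith
    · intro ρ hρ
      obtain ⟨-, him⟩ := hUri (h 0 - c 0) (h 1 - c 1)
      have hq : (l : ℝ) ≤ ((h 1 - c 1 : ℤ) : ℝ) := by exact_mod_cast hh1
      constructor
      · refine le_trans ?_ (hnorm_im _)
        rw [Complex.sub_im, Complex.ofReal_im, sub_zero, him, abs_mul, abs_of_pos hδ]
        nlinarith [le_abs_self (((h 1 - c 1 : ℤ) : ℝ) - β.im)]
      · refine le_trans ?_ (hnorm_im _)
        have e : ((ρ : ℂ) * Complex.I ^ 2).im = 0 := by simp [pow_two]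
        rw [Complex.sub_im, e, sub_zero, him, abs_mul, abs_of_pos hδ]
        nlinarith [le_abs_self (((h 1 - c 1 : ℤ) : ℝ) - β.im)]
  · -- three quadrants
    obtain ⟨vE, vX, W₀, hW₀e, hW₀s, hvE, hvX, h, hh, hh1⟩ :=
      exists_sectorWalk_three hl hx₁ hy₀ T' haT' hbT' hTs' hTe' B' haB' hbB' hBs' hBe' L' haL' hbL'
        hLs' hLe' R' haR' hbR' hRs' hRe'
    refine mem_discreteCrossing_of_sectorWalk D (Or.inr (Or.inr rfl)) hfront hA₁ hA₂ hΩ hlam hP₁ne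
      hP₂ne hP₁a hP₁b hP₂a hP₂b hδ hcb hl hlaml hfit hκl hbulk W₀ hW₀e (fun z hz => ?_) hvE ?_ ?_ hh ?_
    · have := hW₀s z hz
      exact ⟨⟨fun h => absurd h (by norm_num), fun h => absurd h (by norm_num), fun _ => this.1⟩,
        this.2.1, this.2.2⟩
    · obtain ⟨hre, him⟩ := hUri (vX 0 - c 0) (vX 1 - c 1)
      have e1 : ∀ w : ℂ, (w * (-Complex.I) ^ 3).re = -w.im := fun w => by simp [pow_succ]
      have e2 : ∀ w : ℂ, (w * (-Complex.I) ^ 3).im = w.re := fun w => by simp [pow_succ]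
      rw [e1, e2, hre, him, hvX.1, abs_mul, abs_of_pos hδ]
      have hq : ((vX 1 - c 1 : ℤ) : ℝ) ≤ -(l : ℝ) := by exact_mod_cast hvX.2
      have hp : |(((⌈β.re⌉ - 1 : ℤ)) : ℝ) - β.re| ≤ 1 := by
        push_cast; exact abs_le.2 ⟨by linarith, by linarith⟩
      exact ⟨by nlinarith, by nlinarith⟩
    · refine ⟨vX + Pi.single 0 1, (zdGraph_two_adj_iff _ _).2 (Or.inl ⟨by simp, by simp⟩),
        ?_, ?_, fun hsec => ?_⟩
      · have := abs_le.1 (hW₀s vX W₀.end_mem_support).2.1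
        simp only [Pi.add_apply, Pi.single_eq_same]; rw [abs_le]; omega
      · have := abs_le.1 (hW₀s vX W₀.end_mem_support).2.2
        simp only [Pi.add_apply, Pi.single_eq_of_ne (one_ne_zero), add_zero]; rw [abs_le]; omega
      · obtain ⟨hre, him⟩ := hUri ((vX + Pi.single 0 1 : Site 2) 0 - c 0)
          ((vX + Pi.single 0 1 : Site 2) 1 - c 1)
        have hq : ((vX 1 - c 1 : ℤ) : ℝ) ≤ -(l : ℝ) := by exact_mod_cast hvX.2
        have e0 : (vX + Pi.single 0 1 : Site 2) 0 - c 0 = ⌈β.re⌉ := by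
          simp only [Pi.add_apply, Pi.single_eq_same]; omega
        have e1 : (vX + Pi.single 0 1 : Site 2) 1 - c 1 = vX 1 - c 1 := by
          simp only [Pi.add_apply, Pi.single_eq_of_ne (one_ne_zero), add_zero]
        rcases hsec.2.2 rfl with h1 | h1
        · rw [him, e1] at h1
          nlinarith
        · rw [hre, e0] at h1
          nlinarith
    · intro ρ hρ
      obtain ⟨-, him⟩ := hUri (h 0 - c 0) (h 1 - c 1)
      have hq : (l : ℝ) ≤ ((h 1 - c 1 : ℤ) : ℝ) := by exact_mod_cast hh1
      constructor
      · refine le_trans ?_ (hnorm_im _)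
        rw [Complex.sub_im, Complex.ofReal_im, sub_zero, him, abs_mul, abs_of_pos hδ]
        nlinarith [le_abs_self (((h 1 - c 1 : ℤ) : ℝ) - β.im)]
      · refine le_trans ?_ ((le_abs_self _).trans (hnorm_im _))
        have e : ((ρ : ℂ) * Complex.I ^ 3).im = -ρ := by simp [pow_succ]
        rw [Complex.sub_im, e, him]
        nlinarith

end Summit.CriticalPhenomena.CardyFormulaZ2.Cruxes.RectilinearCardy.ExcursionKernelCovariance

end
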